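import Literature.MathematicalPhysics.QuantumFieldTheory.Balaban1983to89.B1Ineq358TreeLength
import Literature.MathematicalPhysics.QuantumFieldTheory.Balaban1983to89.B3Eq32ExpFactor

/-!
# `Balaban1983to89.B3BoxTreeLengthLowerBound` — T. Bałaban, *(Higgs)₂,₃ quantum fields in a finite volume. III. Renormalization*,
Commun. Math. Phys. **88** (1983) 411–445 [Balaban1983Higgs3], (1.33) p. 420 [PDF 10]: *"d({□(v)}_{v∈G}) denotes a length of a shortest
tree graph connecting the vertices v localized in □(v), v ∈ G"*, and p. 432 [PDF 22]: *"if two vertices, v, v′ have localizations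
satisfying dist(□(v), □(v′)) ≧ 1 …"* (the cube distance of (3.1)) — THE TREE LENGTH OF THE LOCALIZATION CUBES DOMINATES EVERY CUBE
DISTANCE: `d({□(v)}) ≧ η·dist(□(u), □(w))` for all vertices `u, w` — PROVED on p19's η-cube carrier (`B3Ineq213TreeLength.boxTreeLen`,
`B3Ineq215.Cube.distI`, `B3Eq32ExpFactor.boxDistI`), complementing p19's UPPER bounds `boxTreeLen_le_sum_lines` /
`boxTreeLen_le_sum_boxDistI` with the lower bound.

statement-level skeleton of published theorems with citation tags; proofs where landed; nothing here is a claim about the Yang–Mills mass gap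

PDF held: `paper:balaban1983-higgs-2-3-quantum-fields-finite-volume` (journal page = PDF page + 410), p. 420 `p0010.txt` L34, p. 432 as quoted
in p19's `B3Eq32ExpFactor`.

CITATION HEADER (lean-in-tree rule).  Cell `lit-balaban` (HOME `run/shared/lean/pub/lit-balaban/`), unit `lit-balaban-typer` gen 17
(literature-prover-lit-balaban-typer-g17-0; TAKING line HOME/STATUS.md 2026-08-22T07:22:24Z, free-target protocol G.5-34(d); stem check: no
`BoxTree*` file, p19's files prove upper bounds only).  SKELETON rows served (cells only, no head change; owner r15, p19 FYI): **B3.Prop1**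
((1.33): `d({□(v)})`), **B3.Eq3.1** (the cube distance `dist(□(v), □(v′))`).  USED BY NAME, never restated: p19's `B3Ineq215.Cube`
(`lo`/`hi`/`gap`/`distI`), `B3Ineq213.{pts, supDist, supDist_comm, supDist_self, dist_le_supDist, treeLen, edgeLen, edgeLen_nonneg,
boxPositions, mem_boxPositions, boxPositions_nonempty, boxTreeLen}`, `B3Eq32ExpFactor.{boxDistI, lo_le_and_lt_hi, supDist_triangle}`, and the
typer's `B1Ineq358TreeLength.le_treeLen` (`ρ(u, w) ≦ treeLen ρ` for every pseudo-metric `ρ`).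

THE ARGUMENT.  A lattice point `x` of the cube `A` has `lo_μ(A) ≦ x_μ < hi_μ(A)` in every direction; hence for `x ∈ A`, `y ∈ B` the
coordinate gap `gap_μ(A, B) = max(lo_μ(A) − hi_μ(B), lo_μ(B) − hi_μ(A))` (truncated) is `≦ |x_μ − y_μ|`, so `dist(A, B) = max_μ gap_μ ≦
|x − y|_∞` (`distI_le_supDist`).  The edge length `ρ_x(u, w) = η|x_u − x_w|_∞` of a position tuple is a pseudo-metric on the vertex set
(zero diagonal, symmetric, triangle inequality, `≧ 0`), so `le_treeLen` gives `η·dist(□(u), □(w)) ≦ ρ_x(u, w) ≦ treeLen ρ_x` for every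
admissible `x` (`eta_boxDistI_le_treeLen`), and the infimum over `x` is `boxTreeLen` (`eta_boxDistI_le_boxTreeLen`, `L ≧ 1`).  Consequently
`e^{−δ·d({□(v)})} ≦ e^{−δη·dist(□(u), □(w))}` for `δ ≧ 0` (`exp_neg_boxTreeLen_le`): the decay factor of (1.33) is at least as strong as the
two-cube decay between any two localization cubes.

HONEST SCOPE.  Pure lattice geometry; nothing about amplitudes, (1.33) or (3.1) themselves.  The Steiner question does not arise here
(p19's `boxTreeLen` minimises over positions inside the GIVEN cubes and over connecting edge sets on the vertex set).  Nothing here is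
summit progress.
-/

open Finset

namespace Literature.MathematicalPhysics.QuantumFieldTheory.Balaban1983to89.B3BoxTreeLengthLowerBound

open B3Ineq215 B3Ineq213
open B3Eq32ExpFactor (boxDistI lo_le_and_lt_hi supDist_triangle)
open B1Ineq358TreeLength (le_treeLen)

variable {d : ℕ} {L : ℕ}

/-! ## §1 Points of two cubes are at least the cube distance apart -/

/-- In every direction the coordinate gap of two cubes is at most the coordinate distance of any two of their lattice points:
`gap_μ(A, B) ≦ |x_μ − y_μ|` for `x ∈ A`, `y ∈ B`. [cite: Balaban1983Higgs3, (3.1) p.432; (2.14) p.427] -/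
theorem gap_le_dist (hL : 0 < L) {A B : Cube d} {x y : Fin d → ℕ} (hx : x ∈ pts L A) (hy : y ∈ pts L B) (μ : Fin d) :
    Cube.gap L A B μ ≤ Nat.dist (x μ) (y μ) := by
  obtain ⟨hx1, hx2⟩ := lo_le_and_lt_hi hL hx μ
  obtain ⟨hy1, hy2⟩ := lo_le_and_lt_hi hL hy μ
  unfold Cube.gap Nat.dist
  omega

/-- **`dist(□, □′) ≦ |x − y|_∞`** for lattice points `x ∈ □`, `y ∈ □′` (sup over the directions of `gap_le_dist`).
[cite: Balaban1983Higgs3, (3.1) p.432; (2.14) p.427] -/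
theorem distI_le_supDist (hL : 0 < L) {A B : Cube d} {x y : Fin d → ℕ} (hx : x ∈ pts L A) (hy : y ∈ pts L B) :
    Cube.distI L A B ≤ supDist x y :=
  Finset.sup_le fun μ _ => (gap_le_dist hL hx hy μ).trans (dist_le_supDist x y μ)

/-! ## §2 The tree length of the localization cubes dominates every cube distance -/

section Boxes

variable {V : Type*} [Fintype V] [DecidableEq V]

/-- For an admissible position tuple (`x_v ∈ □(v)`), the edge length `η|x_u − x_w|_∞` is at least `η·dist(□(u), □(w))`.
[cite: Balaban1983Higgs3, (1.33) p.420; (3.1) p.432] -/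
theorem eta_boxDistI_le_edgeLen (hL : 0 < L) {k : ℕ} {box : V → Fin d → ℕ} {x : V → Fin d → ℕ}
    (hx : x ∈ boxPositions L k box) (u w : V) :
    ((L : ℝ) ^ k)⁻¹ * (boxDistI L k box u w : ℝ) ≤ edgeLen L k x u w := by
  have hmem := (mem_boxPositions.1 hx)
  have h : (boxDistI L k box u w : ℝ) ≤ (supDist (x u) (x w) : ℝ) := by
    exact_mod_cast distI_le_supDist hL (hmem u) (hmem w)
  unfold edgeLen
  exact mul_le_mul_of_nonneg_left h (by positivity)

/-- **`η·dist(□(u), □(w)) ≦ treeLen ρ_x`** for every admissible position tuple `x`: the edge length `ρ_x(u, w) = η|x_u − x_w|_∞` is a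
pseudo-metric on the vertices, so the typer's `le_treeLen` applies, and `ρ_x(u, w) ≧ η·dist(□(u), □(w))`.
[cite: Balaban1983Higgs3, (1.33) p.420; (3.1) p.432] -/
theorem eta_boxDistI_le_treeLen (hL : 0 < L) {k : ℕ} {box : V → Fin d → ℕ} {x : V → Fin d → ℕ}
    (hx : x ∈ boxPositions L k box) (u w : V) :
    ((L : ℝ) ^ k)⁻¹ * (boxDistI L k box u w : ℝ) ≤ treeLen (edgeLen L k x) := by
  refine (eta_boxDistI_le_edgeLen hL hx u w).trans ?_
  refine le_treeLen (edgeLen L k x) (fun a => ?_) (fun a b => ?_) (fun a b c => ?_) (fun a b => edgeLen_nonneg L k x a b) u w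
  · simp [edgeLen, supDist_self]
  · simp [edgeLen, supDist_comm (x a) (x b)]
  · unfold edgeLen
    rw [← mul_add]
    refine mul_le_mul_of_nonneg_left ?_ (by positivity)
    exact_mod_cast supDist_triangle (x a) (x b) (x c)

/-- **`d({□(v)}_{v∈G}) ≧ η·dist(□(u), □(w))`** for all vertices `u, w` (`L ≧ 1`): p19's `boxTreeLen` — *"a length of a shortest tree
graph connecting the vertices v localized in □(v)"* — is the infimum of `treeLen ρ_x` over the admissible position tuples, each of which
obeys `eta_boxDistI_le_treeLen`. [cite: Balaban1983Higgs3, (1.33) p.420; (3.1) p.432] -/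
theorem eta_boxDistI_le_boxTreeLen (hL : 0 < L) (k : ℕ) (box : V → Fin d → ℕ) (u w : V) :
    ((L : ℝ) ^ k)⁻¹ * (boxDistI L k box u w : ℝ) ≤ boxTreeLen L k box := by
  obtain ⟨x₀, hx₀⟩ := boxPositions_nonempty hL k box
  unfold boxTreeLen
  refine le_csInf ⟨_, ⟨x₀, mem_coe.2 hx₀, rfl⟩⟩ ?_
  rintro _ ⟨x, hx, rfl⟩
  exact eta_boxDistI_le_treeLen hL (mem_coe.1 hx) u w

/-- In lattice units of the cubes (`dist` an integer number of η-steps, `η = L^{−k}`): if `dist(□(u), □(w)) ≧ n` then `d({□(v)}) ≧ η·n`.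
[cite: Balaban1983Higgs3, (1.33) p.420; (3.1) p.432] -/
theorem eta_mul_le_boxTreeLen_of_le_boxDistI (hL : 0 < L) (k : ℕ) (box : V → Fin d → ℕ) {u w : V} {n : ℕ}
    (hn : n ≤ boxDistI L k box u w) :
    ((L : ℝ) ^ k)⁻¹ * (n : ℝ) ≤ boxTreeLen L k box :=
  (mul_le_mul_of_nonneg_left (by exact_mod_cast hn) (by positivity)).trans (eta_boxDistI_le_boxTreeLen hL k box u w)

/-- **The decay factor of (1.33) is at least as strong as any two-cube decay**: `e^{−δ·d({□(v)})} ≦ e^{−δ·η·dist(□(u), □(w))}` for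
`δ ≧ 0`. [cite: Balaban1983Higgs3, (1.33) p.420; (3.1) p.432] -/
theorem exp_neg_boxTreeLen_le (hL : 0 < L) (k : ℕ) (box : V → Fin d → ℕ) (u w : V) {δ : ℝ} (hδ : 0 ≤ δ) :
    Real.exp (-(δ * boxTreeLen L k box))
      ≤ Real.exp (-(δ * (((L : ℝ) ^ k)⁻¹ * (boxDistI L k box u w : ℝ)))) :=
  Real.exp_le_exp.2 (neg_le_neg (mul_le_mul_of_nonneg_left (eta_boxDistI_le_boxTreeLen hL k box u w) hδ))

end Boxes

end Literature.MathematicalPhysics.QuantumFieldTheory.Balaban1983to89.B3BoxTreeLengthLowerBound
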